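import Summits.CriticalPhenomena.PercolationContinuityZ3.Theorems.PercNearOneGluingNoHeavyLowerTailSahiGridPatternOrthantGrid

/-!
# `NoHeavyLowerTail` (crux stmt-CriticalPhenomena-4575), Sahi programme: **GOOD TRIPLES ARE CLOSED UNDER BLOCK PRODUCTS, EVERY DIMENSION** —
# the coefficientwise (Latin) form of the independent-product formula for Sahi's `E₃`

Support file (seat `prim-sahi-p1`, generation 10; `--supports stmt-CriticalPhenomena-4575`).  Pure proofs, no definitions, no `sorry`,
standard axioms.  Vocabulary of `…SahiGridPattern{,SliceForm,ZDecomp,Harris,Kleitman,TwoLayerTop}` (`Pd`, `sStarD`, `ind`, `TotDist`, `thirdPt`,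
`sStarD_counting`, `sum_ind_totDist_le`, `sum_totDist_eq_sum_sets`).

THE MATHEMATICS.  `P_d = [3]^d`, `J ⊆ [d]` a block of axes.  A set `X ⊆ P_d` is `J`-MEASURABLE if membership of `x` depends only on `(x_a)_{a∈J}`.
A BLOCK-PRODUCT triple is `(A'∩A'', B'∩B'', C'∩C'')` with `A', B', C'` `J`-measurable and `A'', B'', C''` `Jᶜ`-measurable (under `P_d ≅ [3]^J × [3]^{Jᶜ}`:
`A = A_J × A_{Jᶜ}` etc.).
**THEOREM (`sStarD_nonneg_of_blockProduct`, every `d`, every `J`).**  If the six sets are up-sets and the two CYLINDER triples are good,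
`0 ≤ sStarD A' B' C'` and `0 ≤ sStarD A'' B'' C''`, then the block-product triple is good: `0 ≤ sStarD (A'∩A'') (B'∩B'') (C'∩C'')`.
So the class of up-set triples satisfying the pattern inequality is closed under block products; iterating, every triple whose three sets are
products of up-sets over a common decomposition of the axes into blocks on which `PatternPos` is known (blocks of `≤ 3` axes: kernel; `4`: certified)
satisfies it, in every dimension — the finest case (one-axis blocks: all three sets ORTHANTS) being the coefficientwise form of Lieb–Sahi's theorem for
boxes (Lieb–Sahi 2022) at order `3`.
PROOF.  Write the counting form `sStarD = 2·2^d·T − N_a − N_b − N_c + M` (`sStarD_counting`; `T = |ABC|`, `N_a = N(A;B∩C)`, …, `M` = Latin triples).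
(1) EXCHANGE LEMMA (`sum_mul_sum_exchange`): for the mixing map `(u,v) ↦ (u on J, v off J)` — an involution `(u,v) ↦ (mix u v, mix v u)` of `X × X`
on points (`X = P_d`) and on pairs (`X = P_d × P_d`) — and `G'` `J`-measurable, `G''` `Jᶜ`-measurable, `τ` exchange-multiplicative
(`τ(mix u v)τ(mix v u) = τ(u)τ(v)`: the constant `1`, and the totally-distinct indicator on pairs), `(Σ G'τ)(Σ G''τ) = (Σ G'G''τ)(Σ τ)`.  Hence, with
`Σ_pairs [totally distinct] = 3^d·2^d` (`sum_sum_ite_totDist`): `T'·T'' = 3^d·T`, `N'_k·N''_k = 6^d·N_k` (`k = a,b,c`), `M'·M'' = 6^d·M` for the counts of the two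
cylinder triples (primes) and of the product triple.  (2) Coefficientwise Harris: `N'_k ≤ 2^d T'`, `N''_k ≤ 2^d T''`.  (3) ARITHMETIC LEMMA
(`sum_mul_le_of_box_sum`): if `0 ≤ u_k ≤ t₁`, `0 ≤ v_k ≤ t₂` (`k = 1,2,3`), `Σu ≤ 2t₁ + m₁`, `Σv ≤ 2t₂ + m₂`, `m_i ≥ 0`, then `Σ_k u_k v_k ≤ 2t₁t₂ + m₁m₂`
(if `Σu ≤ 2t₁`: `Σ u_kv_k ≤ t₂Σu ≤ 2t₁t₂`; else with `e₁ = Σu − 2t₁ ∈ [0,m₁]`: `2t₁t₂ + m₁m₂ − Σu_kv_k = Σ_k (t₂ − v_k)(u_k − e₁) + (m₁ − e₁)m₂ + e₁(m₂ − e₂) ≥ 0`).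
With `t_i = 2^d T^{(i)}`, `u = N'`, `v = N''`, `m_i = M^{(i)}`: `6^d(N_a + N_b + N_c) = Σ_k N'_kN''_k ≤ 2·4^d T'T'' + M'M'' = 6^d(2·2^d T + M)`, i.e. `sStarD ≥ 0`.  ∎
The measure-level shadow (order `3` of the independent-product formula `E_n(ΦΨ) = Σ_π …`, tree `SahiIndependentProducts.sahiE_mul_nonneg_of_indepMoments`,
Sahi 2008 Prop. 12) says that `E₃ ≥ 0` for products of events from two independent good families; the statement here is its coefficientwise / Latin
refinement, with an elementary proof.  HONEST LABEL: a closure property of the conjecture's good class; `PatternPos d` (`d ≥ 4`), Sahi's `C₃` and Kahn's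
conjecture remain OPEN; nothing here asserts them. [this work]
-/

namespace Summit.CriticalPhenomena.PercolationContinuityZ3.Theorems.SahiGridPattern

open Finset SahiGrid3
open scoped BigOperators

variable {d : ℕ}

/-! ### The exchange lemma -/

/-- **Exchange lemma.**  On a finite type with a mixing operation `mix` such that `(u,v) ↦ (mix u v, mix v u)` is an involution, for `G'` invariant
under mixing in the second variable, `G''` invariant in the first, and `τ` exchange-multiplicative:
`(Σ G'τ)·(Σ G''τ) = (Σ G'G''τ)·(Σ τ)`. [this work] -/
theorem sum_mul_sum_exchange {X : Type*} [Fintype X] (mix : X → X → X) (hmix : ∀ u v, mix (mix u v) (mix v u) = u)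
    (G' G'' τ : X → ℤ) (hG' : ∀ u v, G' (mix u v) = G' u) (hG'' : ∀ u v, G'' (mix u v) = G'' v)
    (hτ : ∀ u v, τ (mix u v) * τ (mix v u) = τ u * τ v) :
    (∑ u, G' u * τ u) * (∑ v, G'' v * τ v) = (∑ x, G' x * G'' x * τ x) * (∑ w, τ w) := by
  classical
  let e : X × X ≃ X × X :=
    { toFun := fun x => (mix x.1 x.2, mix x.2 x.1)
      invFun := fun x => (mix x.1 x.2, mix x.2 x.1)
      left_inv := fun x => Prod.ext (hmix x.1 x.2) (hmix x.2 x.1)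
      right_inv := fun x => Prod.ext (hmix x.1 x.2) (hmix x.2 x.1) }
  rw [Finset.sum_mul_sum, Finset.sum_mul_sum]
  calc (∑ u, ∑ v, G' u * τ u * (G'' v * τ v))
      = ∑ x : X × X, G' x.1 * τ x.1 * (G'' x.2 * τ x.2) := (Fintype.sum_prod_type' (fun u v => G' u * τ u * (G'' v * τ v))).symm
    _ = ∑ x : X × X, G' (e x).1 * G'' (e x).1 * τ (e x).1 * τ (e x).2 := by
        refine Finset.sum_congr rfl fun x _ => ?_
        show G' x.1 * τ x.1 * (G'' x.2 * τ x.2) = G' (mix x.1 x.2) * G'' (mix x.1 x.2) * τ (mix x.1 x.2) * τ (mix x.2 x.1)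
        rw [hG', hG'', mul_assoc (G' x.1 * G'' x.2), hτ]; ring
    _ = ∑ x : X × X, G' x.1 * G'' x.1 * τ x.1 * τ x.2 := Equiv.sum_comp e (fun x : X × X => G' x.1 * G'' x.1 * τ x.1 * τ x.2)
    _ = ∑ x, ∑ w, G' x * G'' x * τ x * τ w := Fintype.sum_prod_type' (fun x w => G' x * G'' x * τ x * τ w)

/-! ### Mixing along a block of axes -/

/-- Mixing points of `[3]^d` along `J` is an exchange involution. [this work] -/
theorem mix_mix (J : Finset (Fin d)) (u v : Pd d) :
    (fun a => if a ∈ J then (fun a' => if a' ∈ J then u a' else v a') a else (fun a' => if a' ∈ J then v a' else u a') a) = u := by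
  funext a; by_cases ha : a ∈ J <;> simp [ha]

/-- The number of points totally distinct from a given point of `[3]^d` is `2^d`. [this work] -/
theorem sum_ite_totDist_eq_two_pow (p : Pd d) : (∑ q : Pd d, if TotDist p q = true then (1:ℤ) else 0) = 2 ^ d := by
  have h1 : (∑ q : Pd d, if TotDist p q = true then (1:ℤ) else 0) =
      ∑ x ∈ univ.filter (fun x : Pd d => TotDist x p = true), (1:ℤ) := by
    rw [Finset.sum_filter]
    exact Finset.sum_congr rfl fun q _ => by rw [totDist_symm p q]
  rw [h1, sum_totDist_eq_sum_sets p (fun _ => (1:ℤ)), Finset.sum_const, Finset.card_univ, Fintype.card_finset, Fintype.card_fin]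
  simp

/-- The number of totally distinct ordered pairs of `[3]^d` is `3^d · 2^d`. [this work] -/
theorem sum_sum_ite_totDist (d : ℕ) : (∑ p : Pd d, ∑ q : Pd d, if TotDist p q = true then (1:ℤ) else 0) = 3 ^ d * 2 ^ d := by
  rw [Finset.sum_congr rfl fun p _ => sum_ite_totDist_eq_two_pow p, Finset.sum_const, Finset.card_univ, Fintype.card_fun, Fintype.card_fin,
    Fintype.card_fin]
  simp

/-- Total distinctness of mixed pairs: exchange-multiplicativity of the totally-distinct indicator. [this work] -/
theorem ite_totDist_mix_mul (J : Finset (Fin d)) (p q p' q' : Pd d) :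
    (if TotDist (fun a => if a ∈ J then p a else p' a) (fun a => if a ∈ J then q a else q' a) = true then (1:ℤ) else 0) *
      (if TotDist (fun a => if a ∈ J then p' a else p a) (fun a => if a ∈ J then q' a else q a) = true then (1:ℤ) else 0) =
    (if TotDist p q = true then (1:ℤ) else 0) * (if TotDist p' q' = true then (1:ℤ) else 0) := by
  rw [← ite_and_eq_mul, ← ite_and_eq_mul]
  simp only [totDist_iff]
  have key : ((∀ a, (if a ∈ J then p a else p' a) ≠ (if a ∈ J then q a else q' a)) ∧
      (∀ a, (if a ∈ J then p' a else p a) ≠ (if a ∈ J then q' a else q a))) ↔ ((∀ a, p a ≠ q a) ∧ (∀ a, p' a ≠ q' a)) := by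
    constructor
    · rintro ⟨h1, h2⟩
      refine ⟨fun a => ?_, fun a => ?_⟩
      · by_cases ha : a ∈ J
        · have := h1 a; simp only [ha, if_true] at this; exact this
        · have := h2 a; simp only [ha, if_false] at this; exact this
      · by_cases ha : a ∈ J
        · have := h2 a; simp only [ha, if_true] at this; exact this
        · have := h1 a; simp only [ha, if_false] at this; exact this
    · rintro ⟨h1, h2⟩
      refine ⟨fun a => ?_, fun a => ?_⟩
      · by_cases ha : a ∈ J
        · simp only [ha, if_true]; exact h1 a
        · simp only [ha, if_false]; exact h2 a
      · by_cases ha : a ∈ J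
        · simp only [ha, if_true]; exact h2 a
        · simp only [ha, if_false]; exact h1 a
  rw [if_congr key rfl rfl]

/-- Indicator of a `J`-measurable set at a mixed point. [this work] -/
theorem ind_mix_left (J : Finset (Fin d)) {S : Finset (Pd d)} (hS : ∀ x y : Pd d, (∀ a ∈ J, x a = y a) → (x ∈ S ↔ y ∈ S)) (u v : Pd d) :
    ind S (fun a => if a ∈ J then u a else v a) = ind S u := by
  unfold ind
  rw [if_congr (hS _ u fun a ha => by simp only [ha, if_true]) rfl rfl]

/-- Indicator of a `Jᶜ`-measurable set at a mixed point. [this work] -/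
theorem ind_mix_right (J : Finset (Fin d)) {S : Finset (Pd d)} (hS : ∀ x y : Pd d, (∀ a ∉ J, x a = y a) → (x ∈ S ↔ y ∈ S)) (u v : Pd d) :
    ind S (fun a => if a ∈ J then u a else v a) = ind S v := by
  unfold ind
  rw [if_congr (hS _ v fun a ha => by simp only [ha, if_false]) rfl rfl]

/-! ### Factorisation of the counts of a block-product triple -/

section Factor

variable (J : Finset (Fin d)) {X' Y' Z' X'' Y'' Z'' : Finset (Pd d)}
  (hX' : ∀ x y : Pd d, (∀ a ∈ J, x a = y a) → (x ∈ X' ↔ y ∈ X'))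
  (hY' : ∀ x y : Pd d, (∀ a ∈ J, x a = y a) → (x ∈ Y' ↔ y ∈ Y'))
  (hZ' : ∀ x y : Pd d, (∀ a ∈ J, x a = y a) → (x ∈ Z' ↔ y ∈ Z'))
  (hX'' : ∀ x y : Pd d, (∀ a ∉ J, x a = y a) → (x ∈ X'' ↔ y ∈ X''))
  (hY'' : ∀ x y : Pd d, (∀ a ∉ J, x a = y a) → (x ∈ Y'' ↔ y ∈ Y''))
  (hZ'' : ∀ x y : Pd d, (∀ a ∉ J, x a = y a) → (x ∈ Z'' ↔ y ∈ Z''))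
include hX' hY' hZ' hX'' hY'' hZ''

/-- **Diagonal count**: `T' · T'' = 3^d · T`. [this work] -/
theorem diag_factor :
    (∑ p, ind X' p * ind Y' p * ind Z' p) * (∑ p, ind X'' p * ind Y'' p * ind Z'' p) =
      3 ^ d * ∑ p, ind (X' ∩ X'') p * ind (Y' ∩ Y'') p * ind (Z' ∩ Z'') p := by
  have h := sum_mul_sum_exchange (fun u v : Pd d => fun a => if a ∈ J then u a else v a) (mix_mix J)
    (fun p => ind X' p * ind Y' p * ind Z' p) (fun p => ind X'' p * ind Y'' p * ind Z'' p) (fun _ => (1:ℤ))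
    (fun u v => by simp only [ind_mix_left J hX', ind_mix_left J hY', ind_mix_left J hZ'])
    (fun u v => by simp only [ind_mix_right J hX'', ind_mix_right J hY'', ind_mix_right J hZ'']) (fun _ _ => by ring)
  simp only [mul_one, Finset.sum_const, Finset.card_univ, Fintype.card_fun, Fintype.card_fin, nsmul_eq_mul, Nat.cast_pow,
    Nat.cast_ofNat] at h
  rw [h, mul_comm]
  congr 1
  refine Finset.sum_congr rfl fun p _ => ?_
  rw [ind_inter_eq_mul, ind_inter_eq_mul, ind_inter_eq_mul]; ring

/-- **Pair count**: `N' · N'' = 6^d · N` for `N(X;Y,Z) = #{(p,q) : p ∈ X, q ∈ Y ∩ Z, p, q totally distinct}`. [this work] -/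
theorem pair_factor :
    (∑ p, ∑ q, ind X' p * ind Y' q * ind Z' q * (if TotDist p q = true then (1:ℤ) else 0)) *
        (∑ p, ∑ q, ind X'' p * ind Y'' q * ind Z'' q * (if TotDist p q = true then (1:ℤ) else 0)) =
      3 ^ d * 2 ^ d * ∑ p, ∑ q, ind (X' ∩ X'') p * ind (Y' ∩ Y'') q * ind (Z' ∩ Z'') q * (if TotDist p q = true then (1:ℤ) else 0) := by
  have h := sum_mul_sum_exchange (X := Pd d × Pd d)
    (fun u v => (fun a => if a ∈ J then u.1 a else v.1 a, fun a => if a ∈ J then u.2 a else v.2 a))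
    (fun u v => Prod.ext (mix_mix J u.1 v.1) (mix_mix J u.2 v.2))
    (fun x => ind X' x.1 * ind Y' x.2 * ind Z' x.2) (fun x => ind X'' x.1 * ind Y'' x.2 * ind Z'' x.2)
    (fun x => if TotDist x.1 x.2 = true then (1:ℤ) else 0)
    (fun u v => by simp only [ind_mix_left J hX', ind_mix_left J hY', ind_mix_left J hZ'])
    (fun u v => by simp only [ind_mix_right J hX'', ind_mix_right J hY'', ind_mix_right J hZ''])
    (fun u v => ite_totDist_mix_mul J u.1 u.2 v.1 v.2)
  rw [Fintype.sum_prod_type' (fun p q => ind X' p * ind Y' q * ind Z' q * (if TotDist p q = true then (1:ℤ) else 0)),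
    Fintype.sum_prod_type' (fun p q => ind X'' p * ind Y'' q * ind Z'' q * (if TotDist p q = true then (1:ℤ) else 0)),
    Fintype.sum_prod_type' (fun p q => ind X' p * ind Y' q * ind Z' q * (ind X'' p * ind Y'' q * ind Z'' q) *
      (if TotDist p q = true then (1:ℤ) else 0)),
    Fintype.sum_prod_type' (fun p q => if TotDist p q = true then (1:ℤ) else 0), sum_sum_ite_totDist] at h
  rw [h, mul_comm]
  congr 1
  refine Finset.sum_congr rfl fun p _ => Finset.sum_congr rfl fun q _ => ?_
  rw [ind_inter_eq_mul, ind_inter_eq_mul, ind_inter_eq_mul]; ring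

/-- **Latin count**: `M' · M'' = 6^d · M` for `M(X;Y,Z) = #{(q,r) totally distinct : q ∈ Y, r ∈ Z, thirdPt q r ∈ X}`. [this work] -/
theorem latin_factor :
    (∑ q, ∑ r, ind Y' q * ind Z' r * ind X' (thirdPt q r) * (if TotDist q r = true then (1:ℤ) else 0)) *
        (∑ q, ∑ r, ind Y'' q * ind Z'' r * ind X'' (thirdPt q r) * (if TotDist q r = true then (1:ℤ) else 0)) =
      3 ^ d * 2 ^ d * ∑ q, ∑ r, ind (Y' ∩ Y'') q * ind (Z' ∩ Z'') r * ind (X' ∩ X'') (thirdPt q r) *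
        (if TotDist q r = true then (1:ℤ) else 0) := by
  have third_mix : ∀ u v : Pd d × Pd d, thirdPt (fun a => if a ∈ J then u.1 a else v.1 a) (fun a => if a ∈ J then u.2 a else v.2 a) =
      fun a => if a ∈ J then thirdPt u.1 u.2 a else thirdPt v.1 v.2 a := by
    intro u v; funext a; unfold thirdPt; by_cases ha : a ∈ J <;> simp [ha]
  have h := sum_mul_sum_exchange (X := Pd d × Pd d)
    (fun u v => (fun a => if a ∈ J then u.1 a else v.1 a, fun a => if a ∈ J then u.2 a else v.2 a))
    (fun u v => Prod.ext (mix_mix J u.1 v.1) (mix_mix J u.2 v.2))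
    (fun x => ind Y' x.1 * ind Z' x.2 * ind X' (thirdPt x.1 x.2)) (fun x => ind Y'' x.1 * ind Z'' x.2 * ind X'' (thirdPt x.1 x.2))
    (fun x => if TotDist x.1 x.2 = true then (1:ℤ) else 0)
    (fun u v => by
      show ind Y' _ * ind Z' _ * ind X' (thirdPt _ _) = _
      rw [third_mix, ind_mix_left J hX', ind_mix_left J hY', ind_mix_left J hZ'])
    (fun u v => by
      show ind Y'' _ * ind Z'' _ * ind X'' (thirdPt _ _) = _
      rw [third_mix, ind_mix_right J hX'', ind_mix_right J hY'', ind_mix_right J hZ''])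
    (fun u v => ite_totDist_mix_mul J u.1 u.2 v.1 v.2)
  rw [Fintype.sum_prod_type' (fun q r => ind Y' q * ind Z' r * ind X' (thirdPt q r) * (if TotDist q r = true then (1:ℤ) else 0)),
    Fintype.sum_prod_type' (fun q r => ind Y'' q * ind Z'' r * ind X'' (thirdPt q r) * (if TotDist q r = true then (1:ℤ) else 0)),
    Fintype.sum_prod_type' (fun q r => ind Y' q * ind Z' r * ind X' (thirdPt q r) * (ind Y'' q * ind Z'' r * ind X'' (thirdPt q r)) *
      (if TotDist q r = true then (1:ℤ) else 0)),
    Fintype.sum_prod_type' (fun p q => if TotDist p q = true then (1:ℤ) else 0), sum_sum_ite_totDist] at h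
  rw [h, mul_comm]
  congr 1
  refine Finset.sum_congr rfl fun q _ => Finset.sum_congr rfl fun r _ => ?_
  rw [ind_inter_eq_mul, ind_inter_eq_mul, ind_inter_eq_mul]; ring

end Factor

/-! ### The arithmetic lemma -/

/-- **Box-and-sum lemma.**  If `0 ≤ u_k ≤ t₁`, `v_k ≤ t₂` (`k = 1,2,3`), `t₂ ≥ 0`, `u₁+u₂+u₃ ≤ 2t₁ + m₁`, `v₁+v₂+v₃ ≤ 2t₂ + m₂` and
`m₁, m₂ ≥ 0`, then `u₁v₁ + u₂v₂ + u₃v₃ ≤ 2t₁t₂ + m₁m₂`. [this work] -/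
theorem sum_mul_le_of_box_sum (t₁ t₂ m₁ m₂ u₁ u₂ u₃ v₁ v₂ v₃ : ℤ)
    (hu₁ : 0 ≤ u₁) (hu₂ : 0 ≤ u₂) (hu₃ : 0 ≤ u₃) (ht₂ : 0 ≤ t₂)
    (hu₁t : u₁ ≤ t₁) (hu₂t : u₂ ≤ t₁) (hu₃t : u₃ ≤ t₁) (hv₁t : v₁ ≤ t₂) (hv₂t : v₂ ≤ t₂) (hv₃t : v₃ ≤ t₂)
    (hm₁ : 0 ≤ m₁) (hm₂ : 0 ≤ m₂) (hsu : u₁ + u₂ + u₃ ≤ 2 * t₁ + m₁) (hsv : v₁ + v₂ + v₃ ≤ 2 * t₂ + m₂) :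
    u₁ * v₁ + u₂ * v₂ + u₃ * v₃ ≤ 2 * t₁ * t₂ + m₁ * m₂ := by
  by_cases h : u₁ + u₂ + u₃ ≤ 2 * t₁
  · nlinarith [mul_nonneg (sub_nonneg.2 hv₁t) hu₁, mul_nonneg (sub_nonneg.2 hv₂t) hu₂, mul_nonneg (sub_nonneg.2 hv₃t) hu₃,
      mul_nonneg hm₁ hm₂, mul_nonneg (sub_nonneg.2 h) ht₂]
  · have h' : 2 * t₁ < u₁ + u₂ + u₃ := lt_of_not_ge h
    -- `e₁ = u₁+u₂+u₃ − 2t₁ ∈ (0, m₁]`, and `u_k − e₁ = 2t₁ − (other two) ≥ 0`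
    nlinarith [mul_nonneg (sub_nonneg.2 hv₁t) (show 0 ≤ u₁ - (u₁ + u₂ + u₃ - 2 * t₁) by linarith),
      mul_nonneg (sub_nonneg.2 hv₂t) (show 0 ≤ u₂ - (u₁ + u₂ + u₃ - 2 * t₁) by linarith),
      mul_nonneg (sub_nonneg.2 hv₃t) (show 0 ≤ u₃ - (u₁ + u₂ + u₃ - 2 * t₁) by linarith),
      mul_nonneg (show 0 ≤ m₁ - (u₁ + u₂ + u₃ - 2 * t₁) by linarith) hm₂,
      mul_nonneg (show 0 ≤ u₁ + u₂ + u₃ - 2 * t₁ by linarith) (show 0 ≤ m₂ - (v₁ + v₂ + v₃ - 2 * t₂) by linarith)]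

/-! ### The theorem -/

/-- Sums of products of indicators are nonnegative (bookkeeping). [this work] -/
theorem sum_sum_ind3_ite_nonneg (X Y Z : Finset (Pd d)) (f : Pd d → Pd d → Pd d) :
    0 ≤ ∑ p, ∑ q, ind X p * ind Y q * ind Z (f p q) * (if TotDist p q = true then (1:ℤ) else 0) :=
  Finset.sum_nonneg fun p _ => Finset.sum_nonneg fun q _ =>
    mul_nonneg (mul_nonneg (mul_nonneg (ind_nonneg' _ _) (ind_nonneg' _ _)) (ind_nonneg' _ _)) (by split_ifs <;> norm_num)

/-- Coefficientwise Harris in the shape of the counting form: `N(X;Y,Z) ≤ 2^d · T(X,Y,Z)` for up-sets. [this work] -/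
theorem pairCount_le_diag {X Y Z : Finset (Pd d)} (hX : IsUpperSet (X : Set (Pd d))) (hY : IsUpperSet (Y : Set (Pd d)))
    (hZ : IsUpperSet (Z : Set (Pd d))) :
    (∑ p, ∑ q, ind X p * ind Y q * ind Z q * (if TotDist p q = true then (1:ℤ) else 0)) ≤ 2 ^ d * ∑ p, ind X p * ind Y p * ind Z p := by
  have hYZ : IsUpperSet ((Y ∩ Z : Finset (Pd d)) : Set (Pd d)) := by rw [Finset.coe_inter]; exact hY.inter hZ
  have H := sum_ind_totDist_le d X (Y ∩ Z) hX hYZ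
  simp only [ind_inter_eq_mul] at H
  have e1 : (∑ p, ∑ q, ind X p * (ind Y q * ind Z q) * (if TotDist p q = true then (1:ℤ) else 0)) =
      ∑ p, ∑ q, ind X p * ind Y q * ind Z q * (if TotDist p q = true then (1:ℤ) else 0) :=
    Finset.sum_congr rfl fun p _ => Finset.sum_congr rfl fun q _ => by ring
  have e2 : (∑ p, ind X p * (ind Y p * ind Z p)) = ∑ p, ind X p * ind Y p * ind Z p := Finset.sum_congr rfl fun p _ => by ring
  rw [e1, e2] at H; exact H

/-- **GOOD TRIPLES ARE CLOSED UNDER BLOCK PRODUCTS (every `d`, every block `J`).**  Let `A', B', C'` be `J`-measurable up-sets and `A'', B'', C''`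
`Jᶜ`-measurable up-sets of `[3]^d`.  If the cylinder triples are good, `0 ≤ sStarD A' B' C'` and `0 ≤ sStarD A'' B'' C''`, then so is the block-product
triple: `0 ≤ sStarD (A' ∩ A'') (B' ∩ B'') (C' ∩ C'')`. [this work] -/
theorem sStarD_nonneg_of_blockProduct (J : Finset (Fin d)) {A' B' C' A'' B'' C'' : Finset (Pd d)}
    (hA'u : IsUpperSet (A' : Set (Pd d))) (hB'u : IsUpperSet (B' : Set (Pd d))) (hC'u : IsUpperSet (C' : Set (Pd d)))
    (hA''u : IsUpperSet (A'' : Set (Pd d))) (hB''u : IsUpperSet (B'' : Set (Pd d))) (hC''u : IsUpperSet (C'' : Set (Pd d)))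
    (hA' : ∀ x y : Pd d, (∀ a ∈ J, x a = y a) → (x ∈ A' ↔ y ∈ A'))
    (hB' : ∀ x y : Pd d, (∀ a ∈ J, x a = y a) → (x ∈ B' ↔ y ∈ B'))
    (hC' : ∀ x y : Pd d, (∀ a ∈ J, x a = y a) → (x ∈ C' ↔ y ∈ C'))
    (hA'' : ∀ x y : Pd d, (∀ a ∉ J, x a = y a) → (x ∈ A'' ↔ y ∈ A''))
    (hB'' : ∀ x y : Pd d, (∀ a ∉ J, x a = y a) → (x ∈ B'' ↔ y ∈ B''))
    (hC'' : ∀ x y : Pd d, (∀ a ∉ J, x a = y a) → (x ∈ C'' ↔ y ∈ C''))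
    (hS' : 0 ≤ sStarD A' B' C') (hS'' : 0 ≤ sStarD A'' B'' C'') :
    0 ≤ sStarD (A' ∩ A'') (B' ∩ B'') (C' ∩ C'') := by
  -- the five counts of each triple
  rw [sStarD_counting] at hS' hS'' ⊢
  -- factorisations
  have fT := diag_factor J hA' hB' hC' hA'' hB'' hC''
  have fa := pair_factor J hA' hB' hC' hA'' hB'' hC''
  have fb := pair_factor J hB' hA' hC' hB'' hA'' hC''
  have fc := pair_factor J hC' hA' hB' hC'' hA'' hB''
  have fm := latin_factor J hA' hB' hC' hA'' hB'' hC''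
  -- Harris bounds for the cylinder triples (six of them), with the diagonal written in the order of the counting form
  have ha' := pairCount_le_diag hA'u hB'u hC'u
  have hb' := pairCount_le_diag hB'u hA'u hC'u
  have hc' := pairCount_le_diag hC'u hA'u hB'u
  have ha'' := pairCount_le_diag hA''u hB''u hC''u
  have hb'' := pairCount_le_diag hB''u hA''u hC''u
  have hc'' := pairCount_le_diag hC''u hA''u hB''u
  have eTb' : (∑ p, ind B' p * ind A' p * ind C' p) = ∑ p, ind A' p * ind B' p * ind C' p := Finset.sum_congr rfl fun p _ => by ring
  have eTc' : (∑ p, ind C' p * ind A' p * ind B' p) = ∑ p, ind A' p * ind B' p * ind C' p := Finset.sum_congr rfl fun p _ => by ring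
  have eTb'' : (∑ p, ind B'' p * ind A'' p * ind C'' p) = ∑ p, ind A'' p * ind B'' p * ind C'' p := Finset.sum_congr rfl fun p _ => by ring
  have eTc'' : (∑ p, ind C'' p * ind A'' p * ind B'' p) = ∑ p, ind A'' p * ind B'' p * ind C'' p := Finset.sum_congr rfl fun p _ => by ring
  rw [eTb'] at hb'; rw [eTc'] at hc'; rw [eTb''] at hb''; rw [eTc''] at hc''
  -- nonnegativity of the counts
  have na' := sum_sum_ind3_ite_nonneg A' B' C' (fun _ q => q)
  have nb' := sum_sum_ind3_ite_nonneg B' A' C' (fun _ q => q)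
  have nc' := sum_sum_ind3_ite_nonneg C' A' B' (fun _ q => q)
  have na'' := sum_sum_ind3_ite_nonneg A'' B'' C'' (fun _ q => q)
  have nb'' := sum_sum_ind3_ite_nonneg B'' A'' C'' (fun _ q => q)
  have nc'' := sum_sum_ind3_ite_nonneg C'' A'' B'' (fun _ q => q)
  have nm' := sum_sum_ind3_ite_nonneg B' C' A' (fun q r => thirdPt q r)
  have nm'' := sum_sum_ind3_ite_nonneg B'' C'' A'' (fun q r => thirdPt q r)
  -- the arithmetic lemma with `t_i = 2^d T^{(i)}`, `u = N'`, `v = N''`, `m_i = M^{(i)}`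
  have key := sum_mul_le_of_box_sum (2 ^ d * ∑ p, ind A' p * ind B' p * ind C' p) (2 ^ d * ∑ p, ind A'' p * ind B'' p * ind C'' p)
    _ _ _ _ _ _ _ _ na' nb' nc' (le_trans na'' ha'') ha' hb' hc' ha'' hb'' hc'' nm' nm'' (by linarith) (by linarith)
  -- rewrite the products through the factorisations and divide by `6^d`
  rw [fa, fb, fc, fm] at key
  have e4 : (2:ℤ) * (2 ^ d * ∑ p, ind A' p * ind B' p * ind C' p) * (2 ^ d * ∑ p, ind A'' p * ind B'' p * ind C'' p) =
      2 * (2 ^ d * 2 ^ d) * ((∑ p, ind A' p * ind B' p * ind C' p) * (∑ p, ind A'' p * ind B'' p * ind C'' p)) := by ring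
  rw [e4, fT] at key
  have hpos : (0:ℤ) < 3 ^ d * 2 ^ d := by positivity
  by_contra hneg
  have hneg' := mul_neg_of_pos_of_neg hpos (lt_of_not_ge hneg)
  nlinarith [key, hneg']

/-- **Iterated form / corollary**: with `PatternPos` on the blocks supplied as hypotheses on cylinder triples (both blocks good for ALL triples of
up-sets measurable w.r.t. them, as holds when the block has `≤ 3` axes), every block-product triple of up-sets is good. [this work] -/
theorem sStarD_nonneg_of_blockProduct_of_good (J : Finset (Fin d))
    (hgood' : ∀ X Y Z : Finset (Pd d), IsUpperSet (X : Set (Pd d)) → IsUpperSet (Y : Set (Pd d)) → IsUpperSet (Z : Set (Pd d)) →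
      (∀ x y : Pd d, (∀ a ∈ J, x a = y a) → (x ∈ X ↔ y ∈ X)) → (∀ x y : Pd d, (∀ a ∈ J, x a = y a) → (x ∈ Y ↔ y ∈ Y)) →
      (∀ x y : Pd d, (∀ a ∈ J, x a = y a) → (x ∈ Z ↔ y ∈ Z)) → 0 ≤ sStarD X Y Z)
    (hgood'' : ∀ X Y Z : Finset (Pd d), IsUpperSet (X : Set (Pd d)) → IsUpperSet (Y : Set (Pd d)) → IsUpperSet (Z : Set (Pd d)) →
      (∀ x y : Pd d, (∀ a ∉ J, x a = y a) → (x ∈ X ↔ y ∈ X)) → (∀ x y : Pd d, (∀ a ∉ J, x a = y a) → (x ∈ Y ↔ y ∈ Y)) →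
      (∀ x y : Pd d, (∀ a ∉ J, x a = y a) → (x ∈ Z ↔ y ∈ Z)) → 0 ≤ sStarD X Y Z)
    {A' B' C' A'' B'' C'' : Finset (Pd d)}
    (hA'u : IsUpperSet (A' : Set (Pd d))) (hB'u : IsUpperSet (B' : Set (Pd d))) (hC'u : IsUpperSet (C' : Set (Pd d)))
    (hA''u : IsUpperSet (A'' : Set (Pd d))) (hB''u : IsUpperSet (B'' : Set (Pd d))) (hC''u : IsUpperSet (C'' : Set (Pd d)))
    (hA' : ∀ x y : Pd d, (∀ a ∈ J, x a = y a) → (x ∈ A' ↔ y ∈ A'))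
    (hB' : ∀ x y : Pd d, (∀ a ∈ J, x a = y a) → (x ∈ B' ↔ y ∈ B'))
    (hC' : ∀ x y : Pd d, (∀ a ∈ J, x a = y a) → (x ∈ C' ↔ y ∈ C'))
    (hA'' : ∀ x y : Pd d, (∀ a ∉ J, x a = y a) → (x ∈ A'' ↔ y ∈ A''))
    (hB'' : ∀ x y : Pd d, (∀ a ∉ J, x a = y a) → (x ∈ B'' ↔ y ∈ B''))
    (hC'' : ∀ x y : Pd d, (∀ a ∉ J, x a = y a) → (x ∈ C'' ↔ y ∈ C'')) :
    0 ≤ sStarD (A' ∩ A'') (B' ∩ B'') (C' ∩ C'') :=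
  sStarD_nonneg_of_blockProduct J hA'u hB'u hC'u hA''u hB''u hC''u hA' hB' hC' hA'' hB'' hC''
    (hgood' A' B' C' hA'u hB'u hC'u hA' hB' hC') (hgood'' A'' B'' C'' hA''u hB''u hC''u hA'' hB'' hC'')

end Summit.CriticalPhenomena.PercolationContinuityZ3.Theorems.SahiGridPattern
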